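import Literature.Computability.QuantumComplexity.StabilizerProjector
import Literature.Computability.QuantumComplexity.LightConeAmp
import HarnessLib

/-!
# Measurement-gadget words preparing a stabilizer state (phase-exactly) from its generators

Topic `Literature/Computability/QuantumComplexity`, namespace `StabilizerFormalism`; sequel of
`StabilizerProjector.lean`, third support file for the discharge of
`MehrabanTahmasbi2024_PSharpP_subset_PPoly_of_stabilizerRank_poly` (`StabilizerRankPermanent.lean`).

`StabilizerProjector.lean` presents every stabilizer state `Φ` of the tree as
`s⁻¹ (∏_j ½(1 + g_j)) |z⟩` with explicit signed Paulis `g_j = i^{k_j} X^{a_j} Z^{b_j}`. Here the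
product of projections is realised by an EXPLICIT CLIFFORD WORD of length `O(m²)` over `H`, `S`,
`CNOT` on `m + m` wires (data, then one ancilla per generator) followed by postselection of the
ancillas on `0`: gadget `j` is `H_{a_j} · (controlled-g_j with control a_j) · H_{a_j}`, the
controlled Pauli being `S_{a_j}^{k_j mod 4}`, then `H_l CNOT_{a_j→l} H_l` for every `l` with
`b_j(l) = 1` (controlled-`Z_l`), then `CNOT_{a_j→l}` for every `l` with `a_j(l) = 1` — the textbook
measurement circuit of a Pauli observable with an ancilla (Nielsen–Chuang 2010, §10.5.3, Fig. 10.13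
area; Ex. 4.34), used here as a projection: `(⟨0| ⊗ 1) H c-g H (|0⟩ ⊗ ψ) = ½(1 + g)ψ`. Hence (main
result, **`exists_gadget_presentation`**): for every `Φ ∈ stabilizerStates m` there are gadget data
`d`, a label `z` and `s ≠ 0` with

  `projZ m (U_{allGadgets d} |z 0^m⟩) = s · Φ`     (`U` the matrix `prodZeta ζ` of the word, any `ζ`),

an `O(m²)`-size, phase-exact description of `Φ` by a `T`-free Clifford+`T` gate list — the form of
"the full description of `φ₁, …, φ_r`" (Mehraban–Tahmasbi 2024, proof of Thm. 1.6) that the tree's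
path-sum amplitude evaluator (`CliffordTSymbolicPaths.lean`) can consume.

Contents: the component calculus `comp y Θ = Θ(·, y)` on `m + m` wires and the Schrödinger-picture
action of `H`/`S` on an ancilla, `CNOT` ancilla→data and `H` on data (from
`LightCone.semZeta_mulVec_apply_H/S/CNOT`); controlled blocks compose (`ctrl_append`); the `X`-,
`Z`- and phase parts (`ctrl_cxOps`, `ctrl_czOps`, `ctrl_sOps`) multiply to `i^k X^a Z^b`
(`ctrl_mid`); the one-gadget formula (`comp_gadget`) and the induction over the generators
(`gadgets_spec`).

## References

* S. Mehraban, M. Tahmasbi, arXiv:2305.10277 (STOC 2024), proof of Thm. 1.6, p. 6.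
* M. A. Nielsen, I. L. Chuang, *Quantum Computation and Quantum Information*, CUP 2010, §4.3
  (controlled operations; Ex. 4.34 measuring an operator with an ancilla), §10.5.3 (measurement in
  the stabilizer formalism).
-/

noncomputable section

namespace Literature.Computability.QuantumComplexity

open _root_.Computability Cryptography Matrix LightCone

namespace StabilizerFormalism

variable {m : ℕ}

/-! ### Wires, components, and two bookkeeping lemmas -/

/-- Data wire `l` of the `m + m` register. [folklore] -/
abbrev dW (l : Fin m) : Fin (m + m) := Fin.castAdd m l

/-- Ancilla wire `j` of the `m + m` register. [folklore] -/
abbrev aW (j : Fin m) : Fin (m + m) := Fin.natAdd m j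

/-- Ancilla and data wires are distinct. [folklore] -/
theorem aW_ne_dW (j l : Fin m) : aW j ≠ dW l := by
  intro h
  have := congrArg Fin.val h
  simp at this
  omega

/-- The data component of `Θ` along the ancilla label `y`: `x ↦ Θ(x, y)`. [folklore] -/
def comp (y : QReg m) (Θ : QReg (m + m) → ℂ) : QReg m → ℂ := fun x => Θ (Fin.append x y)

/-- `projZ` is the component along `0^m`. [folklore] -/
theorem projZ_eq_comp (Θ : QReg (m + m) → ℂ) : projZ m Θ = comp (zlab m) Θ := rfl

/-- Evaluation of a component. [folklore] -/
@[simp] theorem comp_apply (y : QReg m) (Θ : QReg (m + m) → ℂ) (x : QReg m) : comp y Θ x = Θ (Fin.append x y) := rfl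

/-- Components are additive. [folklore] -/
theorem comp_add (y : QReg m) (Θ Θ' : QReg (m + m) → ℂ) : comp y (Θ + Θ') = comp y Θ + comp y Θ' := rfl

/-- Components are homogeneous. [folklore] -/
theorem comp_smul (y : QReg m) (c : ℂ) (Θ : QReg (m + m) → ℂ) : comp y (c • Θ) = c • comp y Θ := rfl

/-- Updating a wire of the first block of an appended label. [folklore] -/
theorem update_append_castAdd {t : ℕ} (x : QReg m) (y : QReg t) (l : Fin m) (β : Bool) :
    Function.update (Fin.append x y) (Fin.castAdd t l) β = Fin.append (Function.update x l β) y := by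
  funext i
  refine Fin.addCases (fun l' => ?_) (fun r => ?_) i
  · by_cases h : l' = l
    · subst h
      simp
    · have hne : Fin.castAdd t l' ≠ Fin.castAdd t l := fun e => h (Fin.castAdd_injective _ _ e)
      rw [Function.update_of_ne hne]
      simp [Function.update_of_ne h]
  · have hne : Fin.natAdd m r ≠ Fin.castAdd t l := by
      intro e
      have := congrArg Fin.val e
      simp at this
      omega
    rw [Function.update_of_ne hne]
    simp

/-- The product of a concatenation of gate lists. [folklore] -/
theorem prodZeta_append {N : ℕ} (ζ : ℂ) (gs gs' : List (QGate cliffordT N)) :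
    prodZeta ζ (gs ++ gs') = prodZeta ζ gs' * prodZeta ζ gs := by
  simp [prodZeta, List.map_append, List.reverse_append, List.prod_append]

/-- The product of a singleton. [folklore] -/
@[simp] theorem prodZeta_singleton {N : ℕ} (ζ : ℂ) (g : QGate cliffordT N) : prodZeta ζ [g] = semZeta ζ g := by
  simp [prodZeta]

/-! ### Schrödinger-picture action of the gadget gates on components -/

/-- `H` on ancilla `j`: `Θ'(·, y) = (Θ(·, y[j↦0]) + (-1)^{y_j} Θ(·, y[j↦1]))/√2`. [cite: NielsenChuang2010, §4.2] -/
theorem comp_hOn_aW (ζ : ℂ) (j : Fin m) (Θ : QReg (m + m) → ℂ) (y : QReg m) :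
    comp y (semZeta ζ (hOn (aW j)) *ᵥ Θ) =
      invSqrt2 • (comp (Function.update y j false) Θ +
        (if y j then (-1 : ℂ) else 1) • comp (Function.update y j true) Θ) := by
  funext x
  have h : (semZeta ζ (hOn (aW j)) *ᵥ Θ) (Fin.append x y) =
      invSqrt2 * (Θ (Function.update (Fin.append x y) (aW j) false) +
        (if Fin.append x y (aW j) = true then -1 else 1) * Θ (Function.update (Fin.append x y) (aW j) true)) :=
    semZeta_mulVec_apply_H (ζ := ζ) (wireEmb (aW j)) Θ (Fin.append x y)
  rw [comp_apply, h]
  simp only [Fin.append_right, update_append_natAdd, Pi.smul_apply, Pi.add_apply, comp_apply, smul_eq_mul]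

/-- `S` on ancilla `j`: `Θ'(·, y) = i^{y_j} Θ(·, y)`. [cite: NielsenChuang2010, §4.2] -/
theorem comp_sOn_aW (ζ : ℂ) (j : Fin m) (Θ : QReg (m + m) → ℂ) (y : QReg m) :
    comp y (semZeta ζ (sOn (aW j)) *ᵥ Θ) = (if y j then Complex.I else 1) • comp y Θ := by
  funext x
  have h : (semZeta ζ (sOn (aW j)) *ᵥ Θ) (Fin.append x y) =
      (if Fin.append x y (aW j) = true then Complex.I else 1) * Θ (Fin.append x y) :=
    semZeta_mulVec_apply_S (ζ := ζ) (wireEmb (aW j)) Θ (Fin.append x y)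
  rw [comp_apply, h]
  simp only [Fin.append_right, Pi.smul_apply, comp_apply, smul_eq_mul]

/-- `CNOT` from ancilla `j` to data `l`: `Θ'(x, y) = Θ(x[l ↦ x_l ⊕ y_j], y)`. [cite: NielsenChuang2010, §4.3] -/
theorem comp_cnotOn_aW_dW (ζ : ℂ) (j l : Fin m) (Θ : QReg (m + m) → ℂ) (y : QReg m) :
    comp y (semZeta ζ (cnotOn (aW j) (dW l) (aW_ne_dW j l)) *ᵥ Θ) =
      if y j then pauliOp (Pi.single l true) (zlab m) *ᵥ comp y Θ else comp y Θ := by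
  funext x
  have h : (semZeta ζ (cnotOn (aW j) (dW l) (aW_ne_dW j l)) *ᵥ Θ) (Fin.append x y) =
      Θ (Function.update (Fin.append x y) (dW l) (Fin.append x y (dW l) ^^ Fin.append x y (aW j))) :=
    semZeta_mulVec_apply_CNOT (ζ := ζ) (pairEmb (aW j) (dW l) (aW_ne_dW j l)) Θ (Fin.append x y)
  rw [comp_apply, h]
  simp only [Fin.append_right, Fin.append_left, update_append_castAdd]
  by_cases hy : y j
  · rw [if_pos hy, pauliOp_mulVec_apply, sgn_zero_left, one_mul, comp_apply, bxor_single, hy, Bool.xor_true]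
  · have hy' : y j = false := by simpa using hy
    rw [if_neg hy, hy', Bool.xor_false, Function.update_eq_self, comp_apply]

/-- The pointwise formula of `H` on a wire of an `m`-qubit register. [cite: NielsenChuang2010, §4.2] -/
theorem hOn_mulVec_apply (ζ : ℂ) (l : Fin m) (v : QReg m → ℂ) (x : QReg m) :
    (semZeta ζ (hOn l) *ᵥ v) x =
      invSqrt2 * (v (Function.update x l false) + (if x l = true then -1 else 1) * v (Function.update x l true)) :=
  semZeta_mulVec_apply_H (ζ := ζ) (wireEmb l) v x

/-- A gate on data wire `l` acts on every component: `H` case. [cite: NielsenChuang2010, §4.2] -/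
theorem comp_hOn_dW (ζ : ℂ) (l : Fin m) (Θ : QReg (m + m) → ℂ) (y : QReg m) :
    comp y (semZeta ζ (hOn (dW l)) *ᵥ Θ) = semZeta ζ (hOn l) *ᵥ comp y Θ := by
  funext x
  have h : (semZeta ζ (hOn (dW l)) *ᵥ Θ) (Fin.append x y) =
      invSqrt2 * (Θ (Function.update (Fin.append x y) (dW l) false) +
        (if Fin.append x y (dW l) = true then -1 else 1) * Θ (Function.update (Fin.append x y) (dW l) true)) :=
    semZeta_mulVec_apply_H (ζ := ζ) (wireEmb (dW l)) Θ (Fin.append x y)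
  rw [comp_apply, h, hOn_mulVec_apply]
  simp only [Fin.append_left, update_append_castAdd, comp_apply]

/-! ### Controlled blocks: composition and the elementary cases -/

/-- **Controlled blocks compose**: if `ops₁` applies `D₁` to the data exactly when ancilla `j` reads
`1`, and `ops₂` applies `D₂` likewise, then `ops₁ ++ ops₂` applies `D₂ D₁`. [cite: NielsenChuang2010, §4.3] -/
theorem ctrl_append {j : Fin m} {D₁ D₂ : Matrix (QReg m) (QReg m) ℂ} {ops₁ ops₂ : List (QGate cliffordT (m + m))}
    (h₁ : ∀ (ζ : ℂ) (Θ : QReg (m + m) → ℂ) (y : QReg m),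
      comp y (prodZeta ζ ops₁ *ᵥ Θ) = if y j then D₁ *ᵥ comp y Θ else comp y Θ)
    (h₂ : ∀ (ζ : ℂ) (Θ : QReg (m + m) → ℂ) (y : QReg m),
      comp y (prodZeta ζ ops₂ *ᵥ Θ) = if y j then D₂ *ᵥ comp y Θ else comp y Θ)
    (ζ : ℂ) (Θ : QReg (m + m) → ℂ) (y : QReg m) :
    comp y (prodZeta ζ (ops₁ ++ ops₂) *ᵥ Θ) = if y j then (D₂ * D₁) *ᵥ comp y Θ else comp y Θ := by
  rw [prodZeta_append, ← Matrix.mulVec_mulVec, h₂, h₁]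
  by_cases hy : y j
  · simp [hy, Matrix.mulVec_mulVec]
  · simp [hy]

/-- The empty block is controlled-`1`. [folklore] -/
theorem ctrl_nil (j : Fin m) (ζ : ℂ) (Θ : QReg (m + m) → ℂ) (y : QReg m) :
    comp y (prodZeta ζ ([] : List (QGate cliffordT (m + m))) *ᵥ Θ) =
      if y j then (1 : Matrix (QReg m) (QReg m) ℂ) *ᵥ comp y Θ else comp y Θ := by
  simp

/-- `CNOT_{a_j → l}` is controlled-`X_l`. [cite: NielsenChuang2010, §4.3] -/
theorem ctrl_cnot (j l : Fin m) (ζ : ℂ) (Θ : QReg (m + m) → ℂ) (y : QReg m) :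
    comp y (prodZeta ζ [cnotOn (aW j) (dW l) (aW_ne_dW j l)] *ᵥ Θ) =
      if y j then pauliOp (Pi.single l true) (zlab m) *ᵥ comp y Θ else comp y Θ := by
  rw [prodZeta_singleton, comp_cnotOn_aW_dW]

/-- The matrix of `H` on wire `l` is the placement of `hGate` (definitional). [folklore] -/
theorem semZeta_hOn_eq (ζ : ℂ) (l : Fin m) : semZeta ζ (hOn l) = placeGate (wireEmb l) hGate := rfl

/-- `H_l X_l = Z_l H_l`. [cite: NielsenChuang2010, §4.2 Ex. 4.18] -/
theorem hGate_mul_xOp (l : Fin m) :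
    placeGate (wireEmb l) hGate * pauliOp (Pi.single l true) (zlab m) = zOp l * placeGate (wireEmb l) hGate := by
  rw [hGate_mul_pauliOp]
  have ha : Function.update (Pi.single l true : QReg m) l (zlab m l) = zlab m := by
    funext i; by_cases h : i = l
    · subst h; simp
    · rw [Function.update_of_ne h, Pi.single_eq_of_ne h]; rfl
  have hb : Function.update (zlab m) l ((Pi.single l true : QReg m) l) = Pi.single l true := by
    rw [Pi.single_eq_same]; exact update_zero_true_eq_single l
  rw [ha, hb]
  simp

/-- `H_l X_l H_l = Z_l`. [cite: NielsenChuang2010, §4.2 Ex. 4.18] -/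
theorem hGate_mul_xOp_mul_hGate (l : Fin m) :
    placeGate (wireEmb l) hGate * pauliOp (Pi.single l true) (zlab m) * placeGate (wireEmb l) hGate = zOp l := by
  rw [hGate_mul_xOp, Matrix.mul_assoc, placeGate_hGate_mul_self, Matrix.mul_one]

/-- `H_l CNOT_{a_j → l} H_l` is controlled-`Z_l`. [cite: NielsenChuang2010, §4.3] -/
theorem ctrl_cz (j l : Fin m) (ζ : ℂ) (Θ : QReg (m + m) → ℂ) (y : QReg m) :
    comp y (prodZeta ζ [hOn (dW l), cnotOn (aW j) (dW l) (aW_ne_dW j l), hOn (dW l)] *ᵥ Θ) =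
      if y j then zOp l *ᵥ comp y Θ else comp y Θ := by
  rw [prodZeta_cons, prodZeta_cons, prodZeta_singleton, ← Matrix.mulVec_mulVec, ← Matrix.mulVec_mulVec,
    comp_hOn_dW, comp_cnotOn_aW_dW, comp_hOn_dW, semZeta_hOn_eq]
  by_cases hy : y j
  · rw [if_pos hy, if_pos hy, Matrix.mulVec_mulVec, Matrix.mulVec_mulVec, hGate_mul_xOp_mul_hGate]
  · rw [if_neg hy, if_neg hy, Matrix.mulVec_mulVec, placeGate_hGate_mul_self, Matrix.one_mulVec]

/-- `S` on the ancilla is controlled-`i`. [cite: NielsenChuang2010, §4.3] -/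
theorem ctrl_s (j : Fin m) (ζ : ℂ) (Θ : QReg (m + m) → ℂ) (y : QReg m) :
    comp y (prodZeta ζ [sOn (aW j)] *ᵥ Θ) =
      if y j then (Complex.I • (1 : Matrix (QReg m) (QReg m) ℂ)) *ᵥ comp y Θ else comp y Θ := by
  rw [prodZeta_singleton, comp_sOn_aW]
  by_cases hy : y j
  · rw [if_pos hy, if_pos hy, Matrix.smul_mulVec, Matrix.one_mulVec]
  · rw [if_neg hy, if_neg hy, one_smul]

/-! ### The `X`-, `Z`- and phase parts of a controlled signed Pauli -/

/-- Restriction of a bit vector to a list of wires. [folklore] -/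
def restrictTo (c : QReg m) (L : List (Fin m)) : QReg m := fun l => decide (l ∈ L) && c l

/-- Restriction to the empty list. [folklore] -/
@[simp] theorem restrictTo_nil (c : QReg m) : restrictTo c [] = zlab m := by
  funext l; simp [restrictTo]

/-- Restriction to all wires. [folklore] -/
@[simp] theorem restrictTo_finRange (c : QReg m) : restrictTo c (List.finRange m) = c := by
  funext l; simp [restrictTo]

/-- Restriction to `l :: L` with `l ∉ L`: add the bit `c l` at `l`. [folklore] -/
theorem restrictTo_cons (c : QReg m) (l : Fin m) (L : List (Fin m)) (hl : l ∉ L) :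
    restrictTo c (l :: L) = if c l then bxor (restrictTo c L) (Pi.single l true) else restrictTo c L := by
  funext i
  by_cases hi : i = l
  · subst hi
    by_cases hc : c i <;> simp [restrictTo, hc, hl]
  · have e : (i ∈ l :: L) ↔ (i ∈ L) := by simp [hi]
    by_cases hc : c l
    · simp only [hc, if_true, bxor_apply, Pi.single_eq_of_ne hi, xor_zero_bool, restrictTo, decide_eq_decide.mpr e]
    · simp only [hc, Bool.false_eq_true, if_false, restrictTo]
      rw [decide_eq_decide.mpr e]

/-- The `X`-part: `CNOT_{a_j → l}` for every `l ∈ L` with `a(l) = 1`. [cite: NielsenChuang2010, §4.3] -/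
def cxOps (j : Fin m) (a : QReg m) (L : List (Fin m)) : List (QGate cliffordT (m + m)) :=
  L.flatMap fun l => if a l then [cnotOn (aW j) (dW l) (aW_ne_dW j l)] else []

/-- The `Z`-part: `H_l CNOT_{a_j → l} H_l` for every `l ∈ L` with `b(l) = 1`. [cite: NielsenChuang2010, §4.3] -/
def czOps (j : Fin m) (b : QReg m) (L : List (Fin m)) : List (QGate cliffordT (m + m)) :=
  L.flatMap fun l => if b l then [hOn (dW l), cnotOn (aW j) (dW l) (aW_ne_dW j l), hOn (dW l)] else []

/-- The phase part: `S_{a_j}^n`. [cite: NielsenChuang2010, §4.3] -/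
def sOps (j : Fin m) (n : ℕ) : List (QGate cliffordT (m + m)) := List.replicate n (sOn (aW j))

/-- One optional controlled-`X_l`. [folklore] -/
theorem ctrl_cx_one (j l : Fin m) (a : QReg m) (ζ : ℂ) (Θ : QReg (m + m) → ℂ) (y : QReg m) :
    comp y (prodZeta ζ (if a l then [cnotOn (aW j) (dW l) (aW_ne_dW j l)] else []) *ᵥ Θ) =
      if y j then (if a l then pauliOp (Pi.single l true) (zlab m) else 1) *ᵥ comp y Θ else comp y Θ := by
  by_cases ha : a l
  · rw [if_pos ha, if_pos ha, ctrl_cnot]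
  · rw [if_neg ha, if_neg ha]; simp

/-- One optional controlled-`Z_l`. [folklore] -/
theorem ctrl_cz_one (j l : Fin m) (b : QReg m) (ζ : ℂ) (Θ : QReg (m + m) → ℂ) (y : QReg m) :
    comp y (prodZeta ζ (if b l then [hOn (dW l), cnotOn (aW j) (dW l) (aW_ne_dW j l), hOn (dW l)] else []) *ᵥ Θ) =
      if y j then (if b l then zOp l else 1) *ᵥ comp y Θ else comp y Θ := by
  by_cases hb : b l
  · rw [if_pos hb, if_pos hb, ctrl_cz]
  · rw [if_neg hb, if_neg hb]; simp

/-- **The `X`-part is controlled-`X^{a|L}`.** [cite: NielsenChuang2010, §4.3] -/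
theorem ctrl_cxOps (j : Fin m) (a : QReg m) :
    ∀ (L : List (Fin m)), L.Nodup → ∀ (ζ : ℂ) (Θ : QReg (m + m) → ℂ) (y : QReg m),
      comp y (prodZeta ζ (cxOps j a L) *ᵥ Θ) =
        if y j then pauliOp (restrictTo a L) (zlab m) *ᵥ comp y Θ else comp y Θ
  | [], _, ζ, Θ, y => by simp [cxOps]
  | l :: L, hnd, ζ, Θ, y => by
    rw [List.nodup_cons] at hnd
    have e : cxOps j a (l :: L) = (if a l then [cnotOn (aW j) (dW l) (aW_ne_dW j l)] else []) ++ cxOps j a L := by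
      simp [cxOps, List.flatMap_cons]
    rw [e, ctrl_append (ctrl_cx_one j l a) (ctrl_cxOps j a L hnd.2), restrictTo_cons a l L hnd.1]
    by_cases ha : a l
    · rw [if_pos ha, if_pos ha, pauliOp_mul, sgn_zero_left, one_smul, bxor_zero]
    · rw [if_neg ha, if_neg ha, Matrix.mul_one]

/-- **The `Z`-part is controlled-`Z^{b|L}`.** [cite: NielsenChuang2010, §4.3] -/
theorem ctrl_czOps (j : Fin m) (b : QReg m) :
    ∀ (L : List (Fin m)), L.Nodup → ∀ (ζ : ℂ) (Θ : QReg (m + m) → ℂ) (y : QReg m),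
      comp y (prodZeta ζ (czOps j b L) *ᵥ Θ) =
        if y j then pauliOp (zlab m) (restrictTo b L) *ᵥ comp y Θ else comp y Θ
  | [], _, ζ, Θ, y => by simp [czOps]
  | l :: L, hnd, ζ, Θ, y => by
    rw [List.nodup_cons] at hnd
    have e : czOps j b (l :: L) =
        (if b l then [hOn (dW l), cnotOn (aW j) (dW l) (aW_ne_dW j l), hOn (dW l)] else []) ++ czOps j b L := by
      simp [czOps, List.flatMap_cons]
    rw [e, ctrl_append (ctrl_cz_one j l b) (ctrl_czOps j b L hnd.2), restrictTo_cons b l L hnd.1]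
    by_cases hb : b l
    · rw [if_pos hb, if_pos hb, pauliOp_mul, sgn_zero_right, one_smul, bxor_zero]
    · rw [if_neg hb, if_neg hb, Matrix.mul_one]

/-- **The phase part is controlled-`i^n`.** [cite: NielsenChuang2010, §4.3] -/
theorem ctrl_sOps (j : Fin m) :
    ∀ (n : ℕ) (ζ : ℂ) (Θ : QReg (m + m) → ℂ) (y : QReg m),
      comp y (prodZeta ζ (sOps j n) *ᵥ Θ) =
        if y j then (Complex.I ^ n • (1 : Matrix (QReg m) (QReg m) ℂ)) *ᵥ comp y Θ else comp y Θ
  | 0, ζ, Θ, y => by simp [sOps]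
  | n + 1, ζ, Θ, y => by
    have e : sOps j (n + 1) = [sOn (aW j)] ++ sOps j n := by simp [sOps, List.replicate_succ]
    rw [e, ctrl_append (ctrl_s j) (ctrl_sOps j n)]
    by_cases hy : y j
    · rw [if_pos hy, if_pos hy, Matrix.smul_mul, Matrix.one_mul, smul_smul, ← pow_succ]
    · rw [if_neg hy, if_neg hy]

/-- The middle block of gadget `j`: phase, then `Z`-part, then `X`-part. [cite: NielsenChuang2010, §10.5.3] -/
def mid (j : Fin m) (d : ℕ × QReg m × QReg m) : List (QGate cliffordT (m + m)) :=
  sOps j (d.1 % 4) ++ (czOps j d.2.2 (List.finRange m) ++ cxOps j d.2.1 (List.finRange m))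

/-- **The middle block is controlled-`g` for `g = i^k X^a Z^b`.** [cite: NielsenChuang2010, §10.5.3] -/
theorem ctrl_mid (j : Fin m) (d : ℕ × QReg m × QReg m) (ζ : ℂ) (Θ : QReg (m + m) → ℂ) (y : QReg m) :
    comp y (prodZeta ζ (mid j d) *ᵥ Θ) = if y j then sPauli d *ᵥ comp y Θ else comp y Θ := by
  obtain ⟨k, a, b⟩ := d
  have h := ctrl_append (ctrl_sOps j (k % 4))
    (ctrl_append (ctrl_czOps j b (List.finRange m) (List.nodup_finRange m))
      (ctrl_cxOps j a (List.finRange m) (List.nodup_finRange m))) ζ Θ y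
  rw [mid, h]
  by_cases hy : y j
  · rw [if_pos hy, if_pos hy, restrictTo_finRange, restrictTo_finRange, pauliOp_mul, sgn_zero_left, one_smul,
      bxor_zero, zero_bxor, Matrix.mul_smul, Matrix.mul_one, sPauli, ← Complex.I_pow_eq_pow_mod]
  · rw [if_neg hy, if_neg hy]

/-! ### One gadget -/

/-- **Gadget `j`**: `H` on the ancilla, the controlled signed Pauli, `H` on the ancilla.
[cite: NielsenChuang2010, §10.5.3] -/
def gadget (j : Fin m) (d : ℕ × QReg m × QReg m) : List (QGate cliffordT (m + m)) :=
  hOn (aW j) :: (mid j d ++ [hOn (aW j)])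

/-- Setting a bit twice. [folklore] -/
theorem update_update (y : QReg m) (j : Fin m) (β β' : Bool) :
    Function.update (Function.update y j β) j β' = Function.update y j β' := Function.update_idem _ _ _

/-- **The one-gadget formula.** With `y₀ = y[j↦0]`, `y₁ = y[j↦1]`:
`Θ'(·,y) = ½((Θ(·,y₀) + Θ(·,y₁)) + (-1)^{y_j} g (Θ(·,y₀) - Θ(·,y₁)))`. [cite: NielsenChuang2010, §10.5.3] -/
theorem comp_gadget (j : Fin m) (d : ℕ × QReg m × QReg m) (ζ : ℂ) (Θ : QReg (m + m) → ℂ) (y : QReg m) :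
    comp y (prodZeta ζ (gadget j d) *ᵥ Θ) =
      (invSqrt2 * invSqrt2) • ((comp (Function.update y j false) Θ + comp (Function.update y j true) Θ) +
        (if y j then (-1 : ℂ) else 1) •
          (sPauli d *ᵥ (comp (Function.update y j false) Θ - comp (Function.update y j true) Θ))) := by
  rw [gadget, prodZeta_cons, prodZeta_append, prodZeta_singleton, ← Matrix.mulVec_mulVec, ← Matrix.mulVec_mulVec,
    comp_hOn_aW, ctrl_mid, ctrl_mid, comp_hOn_aW, comp_hOn_aW]
  simp only [Function.update_self, update_update, Bool.false_eq_true, if_false, if_true, one_smul, neg_one_smul,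
    Matrix.mulVec_smul, smul_smul, ← sub_eq_add_neg]
  funext x
  simp only [Pi.add_apply, Pi.smul_apply, smul_eq_mul]
  ring

/-- If the `y₁`-component vanishes and `y_j = 0`, the gadget applies `½(1 + g)` to the
`y`-component. [cite: NielsenChuang2010, §10.5.3] -/
theorem comp_gadget_of_clean (j : Fin m) (d : ℕ × QReg m × QReg m) (ζ : ℂ) (Θ : QReg (m + m) → ℂ)
    (y : QReg m) (hy : y j = false) (h₁ : comp (Function.update y j true) Θ = 0) :
    comp y (prodZeta ζ (gadget j d) *ᵥ Θ) = halfProj (sPauli d) *ᵥ comp y Θ := by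
  have hy0 : Function.update y j false = y := by rw [← hy, Function.update_eq_self]
  rw [comp_gadget, h₁, hy0, hy, add_zero, sub_zero, invSqrt2_mul_invSqrt2, halfProj, Matrix.smul_mulVec,
    Matrix.add_mulVec, Matrix.one_mulVec]
  simp only [Bool.false_eq_true, if_false, one_smul]

/-- If both the `y₀`- and the `y₁`-component vanish, so does the `y`-component after the gadget.
[cite: NielsenChuang2010, §10.5.3] -/
theorem comp_gadget_eq_zero (j : Fin m) (d : ℕ × QReg m × QReg m) (ζ : ℂ) (Θ : QReg (m + m) → ℂ)
    (y : QReg m) (h₀ : comp (Function.update y j false) Θ = 0) (h₁ : comp (Function.update y j true) Θ = 0) :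
    comp y (prodZeta ζ (gadget j d) *ᵥ Θ) = 0 := by
  rw [comp_gadget, h₀, h₁]
  simp

/-! ### All gadgets -/

/-- The gadgets of the generators in `js`, in order. [cite: NielsenChuang2010, §10.5.3] -/
def gadgetsOf (d : Fin m → ℕ × QReg m × QReg m) (js : List (Fin m)) : List (QGate cliffordT (m + m)) :=
  js.flatMap fun j => gadget j (d j)

/-- Products of projections over concatenated lists. [folklore] -/
theorem projList_append (g : Fin m → Matrix (QReg m) (QReg m) ℂ) (L L' : List (Fin m)) :
    projList g (L ++ L') = projList g L * projList g L' := by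
  simp [projList, List.map_append, List.prod_append]

/-- **Invariant of the gadget sequence.** If the components of `Θ` vanish outside the ancilla set `S`
(i.e. whenever some ancilla `l ∉ S` reads `1`) and `js` is duplicate-free and disjoint from `S`, then
after the gadgets of `js` the components vanish outside `S ∪ js`, and the all-zero component has been
multiplied by `∏_{j ∈ js, last first} ½(1 + g_j)`. [cite: NielsenChuang2010, §10.5.3] -/
theorem gadgets_spec (d : Fin m → ℕ × QReg m × QReg m) (ζ : ℂ) :
    ∀ (js : List (Fin m)), js.Nodup → ∀ (S : Finset (Fin m)), (∀ j ∈ js, j ∉ S) →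
      ∀ (Θ : QReg (m + m) → ℂ), (∀ y : QReg m, (∃ l, l ∉ S ∧ y l = true) → comp y Θ = 0) →
        (∀ y : QReg m, (∃ l, l ∉ S ∧ l ∉ js ∧ y l = true) → comp y (prodZeta ζ (gadgetsOf d js) *ᵥ Θ) = 0) ∧
          comp (zlab m) (prodZeta ζ (gadgetsOf d js) *ᵥ Θ) =
            projList (fun j => sPauli (d j)) js.reverse *ᵥ comp (zlab m) Θ
  | [], _, S, _, Θ, hΘ => by
    refine ⟨fun y ⟨l, hl, _, hy⟩ => ?_, ?_⟩
    · simpa [gadgetsOf] using hΘ y ⟨l, hl, hy⟩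
    · simp [gadgetsOf]
  | j :: js, hnd, S, hS, Θ, hΘ => by
    rw [List.nodup_cons] at hnd
    have hjS : j ∉ S := hS j List.mem_cons_self
    have e : gadgetsOf d (j :: js) = gadget j (d j) ++ gadgetsOf d js := by simp [gadgetsOf, List.flatMap_cons]
    rw [e, prodZeta_append, ← Matrix.mulVec_mulVec]
    set Θ₃ := prodZeta ζ (gadget j (d j)) *ᵥ Θ with hΘ₃
    -- the new state is clean outside `insert j S`
    have hclean : ∀ y : QReg m, (∃ l, l ∉ insert j S ∧ y l = true) → comp y Θ₃ = 0 := by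
      rintro y ⟨l, hl, hy⟩
      rw [Finset.mem_insert, not_or] at hl
      refine comp_gadget_eq_zero j (d j) ζ Θ y (hΘ _ ⟨l, hl.2, ?_⟩) (hΘ _ ⟨l, hl.2, ?_⟩)
      · rw [Function.update_of_ne hl.1]; exact hy
      · rw [Function.update_of_ne hl.1]; exact hy
    have hS' : ∀ j' ∈ js, j' ∉ insert j S := by
      intro j' hj'
      rw [Finset.mem_insert, not_or]
      exact ⟨fun h => hnd.1 (h ▸ hj'), hS j' (List.mem_cons_of_mem _ hj')⟩
    obtain ⟨ih₁, ih₂⟩ := gadgets_spec d ζ js hnd.2 (insert j S) hS' Θ₃ hclean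
    refine ⟨fun y ⟨l, hl, hljs, hy⟩ => ih₁ y ⟨l, ?_, fun h => hljs (List.mem_cons_of_mem _ h), hy⟩, ?_⟩
    · rw [Finset.mem_insert, not_or]
      exact ⟨fun h => hljs (h ▸ List.mem_cons_self), hl⟩
    · rw [ih₂, hΘ₃, comp_gadget_of_clean j (d j) ζ Θ (zlab m) rfl (hΘ _ ⟨j, hjS, by simp⟩), Matrix.mulVec_mulVec,
        List.reverse_cons, projList_append]
      simp [projList]

/-- **All gadgets**, generator `0` first. [cite: NielsenChuang2010, §10.5.3] -/
def allGadgets (d : Fin m → ℕ × QReg m × QReg m) : List (QGate cliffordT (m + m)) := gadgetsOf d (List.finRange m)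

/-- Equality of appended labels forces equality of the blocks. [folklore] -/
theorem append_eq_append_iff (x x' : QReg m) (y y' : QReg m) :
    Fin.append x y = Fin.append x' y' ↔ x = x' ∧ y = y' := by
  constructor
  · intro h
    refine ⟨funext fun i => ?_, funext fun i => ?_⟩
    · have := congrFun h (Fin.castAdd m i); rwa [Fin.append_left, Fin.append_left] at this
    · have := congrFun h (Fin.natAdd m i); rwa [Fin.append_right, Fin.append_right] at this
  · rintro ⟨rfl, rfl⟩; rfl

/-- **The gadget word realises the product of projections**:
`projZ m (U_{allGadgets d} |z 0^m⟩) = (∏_{j<m, last first} ½(1 + g_j)) |z⟩`. [cite: NielsenChuang2010, §10.5.3] -/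
theorem projZ_allGadgets (d : Fin m → ℕ × QReg m × QReg m) (ζ : ℂ) (z : QReg m) :
    projZ m (prodZeta ζ (allGadgets d) *ᵥ basisState (Fin.append z (zlab m))) =
      projList (fun j => sPauli (d j)) (List.finRange m).reverse *ᵥ basisState z := by
  have hΘ : ∀ y : QReg m, (∃ l, l ∉ (∅ : Finset (Fin m)) ∧ y l = true) →
      comp y (basisState (Fin.append z (zlab m))) = 0 := by
    rintro y ⟨l, -, hy⟩
    funext x
    rw [comp_apply, basisState_apply, if_neg, Pi.zero_apply]
    intro h
    have := ((append_eq_append_iff x z y (zlab m)).1 h).2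
    rw [this] at hy
    exact Bool.false_ne_true hy
  obtain ⟨-, h⟩ := gadgets_spec d ζ (List.finRange m) (List.nodup_finRange m) ∅ (fun _ _ => Finset.notMem_empty _)
    (basisState (Fin.append z (zlab m))) hΘ
  rw [projZ_eq_comp, allGadgets, h]
  congr 1
  funext x
  rw [comp_apply, basisState_apply, basisState_apply]
  simp only [append_eq_append_iff, and_true]

/-- The projector formula for the reversed order of factors (all `½(1+g_j)` commute in the end, but no
commutation is needed): `(∏_{last first} ½(1+g_j))|z⟩ = W'[0^m, z] · W|0^m⟩`. [cite: NielsenChuang2010, §10.5.1] -/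
theorem projList_reverse_mulVec_basisState {g : Fin m → Matrix (QReg m) (QReg m) ℂ}
    {W W' : Matrix (QReg m) (QReg m) ℂ} (h : ∀ j, g j * W = W * zOp j) (hWW' : W * W' = 1) (z : QReg m) :
    projList g (List.finRange m).reverse *ᵥ basisState z = W' (zlab m) z • (W *ᵥ zeroState m) := by
  have e : projList g (List.finRange m).reverse = W * projList zOp (List.finRange m).reverse * W' := by
    rw [← projList_mul_eq h, Matrix.mul_assoc, hWW', Matrix.mul_one]
  have hz : ∀ x : QReg m, projList zOp (List.finRange m).reverse *ᵥ basisState x =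
      if x = zlab m then basisState x else 0 := by
    intro x
    rw [zProjList_mulVec_basisState]
    by_cases hx : x = zlab m
    · rw [if_pos hx, if_pos]; intro j _; rw [hx]
    · rw [if_neg hx, if_neg]
      intro h'; exact hx (funext fun j => h' j (List.mem_reverse.2 (List.mem_finRange j)))
  rw [e, ← Matrix.mulVec_mulVec, ← Matrix.mulVec_mulVec, mulVec_basisState W' z]
  have hsum : (fun x => W' x z) = ∑ x : QReg m, W' x z • basisState x := by
    funext x'
    simp only [Finset.sum_apply, Pi.smul_apply, basisState_apply, smul_eq_mul, mul_ite, mul_one, mul_zero,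
      Finset.sum_ite_eq, Finset.mem_univ, if_true]
  rw [hsum, Matrix.mulVec_sum, Finset.sum_eq_single (zlab m)]
  · rw [Matrix.mulVec_smul, hz, if_pos rfl, Matrix.mulVec_smul]
    rfl
  · intro x _ hx
    rw [Matrix.mulVec_smul, hz, if_neg hx, smul_zero]
  · intro h'; exact absurd (Finset.mem_univ _) h'

/-- **Gadget presentation of a stabilizer state** (main result). For every `Φ ∈ stabilizerStates m`
there are gadget data `d` (from the conjugated generators of `Φ`), a basis label `z` and a scalar
`s ≠ 0` such that the `T`-free Clifford+`T` word `allGadgets d` on `m + m` wires, run on `|z 0^m⟩` and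
postselected on ancillas `0^m`, yields exactly `s · Φ`:
`projZ m (U_{allGadgets d} |z 0^m⟩) = s · Φ`. This is the phase-exact polynomial-size description of
the stabilizer states `φᵢ` used as advice in the proof of Mehraban–Tahmasbi 2024, Thm. 1.6.
[cite: MehrabanTahmasbi2024, proof of Theorem 1.6 (arXiv p. 6)] -/
theorem exists_gadget_presentation {Φ : QReg m → ℂ} (hΦ : Φ ∈ stabilizerStates m) :
    ∃ (d : Fin m → ℕ × QReg m × QReg m) (z : QReg m) (s : ℂ), s ≠ 0 ∧
      ∀ ζ : ℂ, projZ m (prodZeta ζ (allGadgets d) *ᵥ basisState (Fin.append z (zlab m))) = s • Φ := by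
  obtain ⟨W, hW, rfl⟩ := hΦ
  obtain ⟨W', -, hl, hr⟩ := exists_inverse_of_mem_cliffordCircuits hW
  obtain ⟨z, hz⟩ := exists_row_entry_ne_zero hl
  refine ⟨genData hW, z, W' (zlab m) z, hz, fun ζ => ?_⟩
  rw [projZ_allGadgets, projList_reverse_mulVec_basisState (gen_mul hW) hr]

/-! ### Size and shape of the word -/

/-- Length of an optional-singleton `flatMap`. [folklore] -/
theorem length_flatMap_ite_le {α β : Type*} (L : List α) (p : α → Bool) (f : α → List β) (c : ℕ)
    (hf : ∀ a, (f a).length ≤ c) : (L.flatMap fun a => if p a then f a else []).length ≤ c * L.length := by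
  induction L with
  | nil => simp
  | cons a L ih =>
    rw [List.flatMap_cons, List.length_append, List.length_cons]
    have : (if p a then f a else []).length ≤ c := by split_ifs <;> simp [hf]
    nlinarith

/-- **The word has length at most `m (4m + 5)`.** [folklore] -/
theorem length_allGadgets_le (d : Fin m → ℕ × QReg m × QReg m) : (allGadgets d).length ≤ m * (4 * m + 5) := by
  have hg : ∀ j, (gadget j (d j)).length ≤ 4 * m + 5 := by
    intro j
    have h1 : (sOps j ((d j).1 % 4)).length ≤ 3 := by
      rw [sOps, List.length_replicate]; have := Nat.mod_lt (d j).1 (by norm_num : 0 < 4); omega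
    have h2 := length_flatMap_ite_le (List.finRange m) (fun l => (d j).2.2 l)
      (fun l => [hOn (dW l), cnotOn (aW j) (dW l) (aW_ne_dW j l), hOn (dW l)]) 3 (fun _ => le_rfl)
    have h3 := length_flatMap_ite_le (List.finRange m) (fun l => (d j).2.1 l)
      (fun l => [cnotOn (aW j) (dW l) (aW_ne_dW j l)]) 1 (fun _ => le_rfl)
    rw [List.length_finRange] at h2 h3
    have e : (gadget j (d j)).length = (sOps j ((d j).1 % 4)).length +
        ((czOps j (d j).2.2 (List.finRange m)).length + ((cxOps j (d j).2.1 (List.finRange m)).length + 1)) + 1 := by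
      simp [gadget, mid, List.length_append]
    rw [e]
    unfold czOps cxOps
    omega
  unfold allGadgets gadgetsOf
  have : ∀ L : List (Fin m), (L.flatMap fun j => gadget j (d j)).length ≤ L.length * (4 * m + 5) := by
    intro L
    induction L with
    | nil => simp
    | cons j L ih => rw [List.flatMap_cons, List.length_append, List.length_cons]; nlinarith [hg j]
  simpa [List.length_finRange] using this (List.finRange m)

/-- Oracle-freeness of an optional-singleton `flatMap`. [folklore] -/
theorem isOracleFree_flatMap_ite {α : Type*} (L : List α) (p : α → Bool) (f : α → List (QGate cliffordT (m + m)))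
    (hf : ∀ a, ∀ g ∈ f a, g.IsOracleFree) : ∀ g ∈ (L.flatMap fun a => if p a then f a else []), g.IsOracleFree := by
  intro g hg
  obtain ⟨a, -, ha⟩ := List.mem_flatMap.1 hg
  by_cases hp : p a
  · rw [if_pos hp] at ha; exact hf a g ha
  · rw [if_neg hp] at ha; exact absurd ha List.not_mem_nil

/-- Every gate of the middle block is oracle-free. [folklore] -/
theorem mid_isOracleFree (j : Fin m) (d : ℕ × QReg m × QReg m) : ∀ g ∈ mid j d, g.IsOracleFree := by
  intro g hg
  rw [mid, List.mem_append, List.mem_append] at hg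
  rcases hg with hg | hg | hg
  · rw [sOps, List.mem_replicate] at hg; rw [hg.2]; exact trivial
  · refine isOracleFree_flatMap_ite _ _ _ (fun l g' hg' => ?_) g hg
    simp only [List.mem_cons, List.not_mem_nil, or_false] at hg'
    rcases hg' with rfl | rfl | rfl <;> exact trivial
  · refine isOracleFree_flatMap_ite _ _ _ (fun l g' hg' => ?_) g hg
    rw [List.mem_singleton] at hg'; rw [hg']; exact trivial

/-- Every gate of a gadget is oracle-free. [folklore] -/
theorem gadget_isOracleFree (j : Fin m) (d : ℕ × QReg m × QReg m) : ∀ g ∈ gadget j d, g.IsOracleFree := by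
  intro g hg
  rw [gadget, List.mem_cons, List.mem_append, List.mem_singleton] at hg
  rcases hg with rfl | hg | rfl
  · exact trivial
  · exact mid_isOracleFree j d g hg
  · exact trivial

/-- **The word is oracle-free** (it consists of `H`, `S`, `CNOT` gates only; in particular it is
`T`-free). [folklore] -/
theorem allGadgets_isOracleFree (d : Fin m → ℕ × QReg m × QReg m) : ∀ g ∈ allGadgets d, g.IsOracleFree := by
  intro g hg
  obtain ⟨j, -, hj⟩ := List.mem_flatMap.1 hg
  exact gadget_isOracleFree j (d j) g hj

/-- Every gate of the middle block is a non-`T` gate. [folklore] -/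
theorem mid_isT (j : Fin m) (d : ℕ × QReg m × QReg m) : ∀ g ∈ mid j d, g.isT = false := by
  intro g hg
  rw [mid, List.mem_append, List.mem_append] at hg
  rcases hg with hg | hg | hg
  · rw [sOps, List.mem_replicate] at hg; rw [hg.2]; rfl
  · obtain ⟨l, -, hl⟩ := List.mem_flatMap.1 hg
    by_cases hb : d.2.2 l
    · rw [if_pos hb] at hl
      simp only [List.mem_cons, List.not_mem_nil, or_false] at hl
      rcases hl with rfl | rfl | rfl <;> rfl
    · rw [if_neg hb] at hl; exact absurd hl List.not_mem_nil
  · obtain ⟨l, -, hl⟩ := List.mem_flatMap.1 hg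
    by_cases ha : d.2.1 l
    · rw [if_pos ha, List.mem_singleton] at hl; rw [hl]; rfl
    · rw [if_neg ha] at hl; exact absurd hl List.not_mem_nil

/-- **The word is `T`-free.** [folklore] -/
theorem allGadgets_isT (d : Fin m → ℕ × QReg m × QReg m) : ∀ g ∈ allGadgets d, g.isT = false := by
  intro g hg
  obtain ⟨j, -, hj⟩ := List.mem_flatMap.1 hg
  rw [gadget, List.mem_cons, List.mem_append, List.mem_singleton] at hj
  rcases hj with rfl | hj | rfl
  · rfl
  · exact mid_isT j (d j) g hj
  · rfl

/-- The word has `T`-count `0`. [folklore] -/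
theorem tCount_allGadgets (d : Fin m → ℕ × QReg m × QReg m) : (⟨allGadgets d⟩ : QCircuit cliffordT (m + m)).tCount = 0 := by
  unfold QCircuit.tCount
  exact List.countP_eq_zero.2 fun g hg => by rw [allGadgets_isT d g hg]; decide

end StabilizerFormalism

end Literature.Computability.QuantumComplexity
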